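import Literature.NumberTheory.LFunctions.BilinearKloostermanNonabelianAmplification
import Summits.Parity.GeneralizedHardyLittlewood.Theorems.PrimeLevelFamEdgeMomentsBeyondDiagonalLayersHeckeReindex
import HarnessLib

/-!
# Route `PrimeLevelFamEdge`, crux K_A `MomentsBeyondDiagonal` (stmt-Parity-20007), line «petersson_layers» v4:
# the PASCADI BRIDGE — Theorem 7.1 in the consumer's variables (ℕ-indexed, dilated supports, coprime on the support)

After Hecke reindexing (`…LayersHeckeReindex`), Bessel separation (`…LayersBesselSeparation`), the unit swap
(`…LayersKloostermanProduct`) and the gcd extraction (`…LayersKloostermanScale`), a term-group of a Petersson layer in the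
print band is a bilinear form `Σ_{x ≤ X} Σ_{y ≤ Y} α_x β_y S(σ₁x, σ₂y; qr')` whose summands all satisfy
`(σ₁x, σ₂y, qr') = 1` (`σ₁, σ₂` = the residual `r`-parts, `x, y` = the flat products).  Pascadi's Theorem 7.1 is typed
(`Literature.NumberTheory.LFunctions.pascadi2025_theorem71`, instance `pascadi2025_theorem71_primeCofactor`) with
ℤ-intervals `(M₀, M₀+M]`, a unit twist `a` and the summation condition `(m, n, c) = 1` as an indicator.  This file is the
bridge (CONDITIONAL on the named fact, taken as a hypothesis — nothing of Pascadi's proof is formalised):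

* `norm_bilinear_dilated_le_of_pascadi`: assuming `pascadi2025_theorem71`, for every `ε > 0` there is `C` such that for all
  primes `q`, `r ≥ 1` with `q ∤ r`, dilations `σ₁, σ₂ ≥ 1`, lengths with `1 ≤ σ₂Y ≤ σ₁X ≤ qr`, and coefficients `α, β : ℕ → ℂ`
  whose SUPPORT is coprime in Pascadi's sense (`α_x β_y ≠ 0 ⇒ (σ₁x, σ₂y, qr) = 1`),
  `‖Σ_{x≤X} Σ_{y≤Y} α_x β_y S(σ₁x, σ₂y; qr)‖ ≤ C ‖α‖₂ ‖β‖₂ (qr)^{1+ε} (r(σ₁X)³(σ₂Y)/(qr)³ + r(σ₁X)²/(qr)² + 1/r)^{1/6}`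
  (the ℓ²-norms are those of `α, β` themselves: dilation does not change them).

Proof: transport `α, β` to ℤ-indexed tables on `(0, σ₁X]`, `(0, σ₂Y]` supported on the multiples of `σ₁, σ₂`
(`sum_filter_dvd_Icc_eq` of `…LayersHeckeReindex`), evaluate Pascadi's indicator on the support, apply the fact with `a = 1`.
Proof only (def-free; CONDITIONAL helper toward `stub_farP` / `stub_band`); K_A NOT proved; nothing about Landau–Siegel zeros.
-/

noncomputable section

open Finset
open Literature.NumberTheory.LFunctions

namespace Summit.Parity.GeneralizedHardyLittlewood.Theorems.MomentsBeyondDiagonal.Layers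

/-! ## §1. Transport between `{1,…,N} ⊂ ℕ` and Pascadi's interval `(0, N] ⊂ ℤ` -/

/-- `(0, N] ∩ ℤ` is the image of `{1, …, N} ⊂ ℕ`. [folklore] -/
theorem interval_zero_eq_map_Icc (N : ℕ) : KSWX2023.interval 0 N = (Icc 1 N).map Nat.castEmbedding := by
  unfold KSWX2023.interval
  ext x
  simp only [zero_add, Finset.mem_Ioc, Finset.mem_map, Finset.mem_Icc, Nat.castEmbedding_apply]
  constructor
  · rintro ⟨h1, h2⟩
    exact ⟨x.toNat, ⟨by omega, by omega⟩, by omega⟩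
  · rintro ⟨u, ⟨hu1, hu2⟩, rfl⟩
    constructor <;> omega

/-- A sum over Pascadi's interval `(0, N]` of a table read through `ℕ` is the sum over `{1,…,N}`. [folklore] -/
theorem sum_interval_zero_eq (N : ℕ) (G : ℤ → ℂ) :
    ∑ m ∈ KSWX2023.interval 0 N, G m = ∑ k ∈ Icc 1 N, G (k : ℤ) := by
  rw [interval_zero_eq_map_Icc, Finset.sum_map]
  rfl

/-- The same for real-valued tables. [folklore] -/
theorem sum_interval_zero_eq_real (N : ℕ) (G : ℤ → ℝ) :
    ∑ m ∈ KSWX2023.interval 0 N, G m = ∑ k ∈ Icc 1 N, G (k : ℤ) := by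
  rw [interval_zero_eq_map_Icc, Finset.sum_map]
  rfl

/-- On a positive multiple: `dilate σ α (σx) = α x` (`σ ≥ 1`). [folklore] -/
theorem dilate_mul {σ : ℕ} (hσ : 0 < σ) (α : ℕ → ℂ) {x : ℕ} (hx : 0 < x) :
    (fun m : ℤ ↦ if 0 < m ∧ σ ∣ m.toNat then α (m.toNat / σ) else 0) ((σ * x : ℕ) : ℤ) = α x := by
  dsimp only
  rw [if_pos ⟨by exact_mod_cast Nat.mul_pos hσ hx, by rw [Int.toNat_natCast]; exact dvd_mul_right σ x⟩,
    Int.toNat_natCast, Nat.mul_div_cancel_left x hσ]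

/-- Off the multiples (within the naturals): `dilate σ α k = 0` if `σ ∤ k`. [folklore] -/
theorem dilate_of_not_dvd {σ : ℕ} (α : ℕ → ℂ) {k : ℕ} (hk : ¬ σ ∣ k) :
    (fun m : ℤ ↦ if 0 < m ∧ σ ∣ m.toNat then α (m.toNat / σ) else 0) (k : ℤ) = 0 := by
  dsimp only
  rw [if_neg]
  rintro ⟨_, h⟩
  rw [Int.toNat_natCast] at h
  exact hk h

/-- **Sums against a dilated table collapse to the original variable**: for `σ ≥ 1`,
`Σ_{m ∈ (0, σX]} dilate σ α m · G m = Σ_{x ≤ X} α x · G(σx)`. [folklore] -/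
theorem sum_interval_dilate_mul {σ : ℕ} (hσ : 0 < σ) (X : ℕ) (α : ℕ → ℂ) (G : ℤ → ℂ) :
    ∑ m ∈ KSWX2023.interval 0 (σ * X), (fun m : ℤ ↦ if 0 < m ∧ σ ∣ m.toNat then α (m.toNat / σ) else 0) m * G m = ∑ x ∈ Icc 1 X, α x * G ((σ * x : ℕ) : ℤ) := by
  rw [sum_interval_zero_eq]
  have hsplit : ∑ k ∈ Icc 1 (σ * X), (fun m : ℤ ↦ if 0 < m ∧ σ ∣ m.toNat then α (m.toNat / σ) else 0) (k : ℤ) * G (k : ℤ) =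
      ∑ k ∈ (Icc 1 (σ * X)).filter (fun k ↦ σ ∣ k), (fun m : ℤ ↦ if 0 < m ∧ σ ∣ m.toNat then α (m.toNat / σ) else 0) (k : ℤ) * G (k : ℤ) := by
    rw [Finset.sum_filter]
    refine Finset.sum_congr rfl fun k _ ↦ ?_
    by_cases hk : σ ∣ k
    · rw [if_pos hk]
    · rw [if_neg hk, dilate_of_not_dvd α hk, zero_mul]
  rw [hsplit, sum_filter_dvd_Icc_eq hσ, Nat.mul_div_cancel_left X hσ]
  refine Finset.sum_congr rfl fun x hx ↦ ?_
  rw [dilate_mul hσ α (mem_Icc.mp hx).1]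

/-- The `ℓ²` norm of a dilated table is that of the original. [folklore] -/
theorem l2Norm_dilate {σ : ℕ} (hσ : 0 < σ) (X : ℕ) (α : ℕ → ℂ) :
    KSWX2023.l2Norm 0 (σ * X) (fun m : ℤ ↦ if 0 < m ∧ σ ∣ m.toNat then α (m.toNat / σ) else 0) = Real.sqrt (∑ x ∈ Icc 1 X, ‖α x‖ ^ 2) := by
  unfold KSWX2023.l2Norm
  congr 1
  rw [sum_interval_zero_eq_real]
  have hsplit : ∑ k ∈ Icc 1 (σ * X), ‖(fun m : ℤ ↦ if 0 < m ∧ σ ∣ m.toNat then α (m.toNat / σ) else 0) (k : ℤ)‖ ^ 2 =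
      ∑ k ∈ (Icc 1 (σ * X)).filter (fun k ↦ σ ∣ k), ‖(fun m : ℤ ↦ if 0 < m ∧ σ ∣ m.toNat then α (m.toNat / σ) else 0) (k : ℤ)‖ ^ 2 := by
    rw [Finset.sum_filter]
    refine Finset.sum_congr rfl fun k _ ↦ ?_
    by_cases hk : σ ∣ k
    · rw [if_pos hk]
    · rw [if_neg hk, dilate_of_not_dvd α hk, norm_zero, zero_pow two_ne_zero]
  have hcast : ∑ k ∈ (Icc 1 (σ * X)).filter (fun k ↦ σ ∣ k), ‖(fun m : ℤ ↦ if 0 < m ∧ σ ∣ m.toNat then α (m.toNat / σ) else 0) (k : ℤ)‖ ^ 2 =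
      ∑ x ∈ Icc 1 (σ * X / σ), ‖(fun m : ℤ ↦ if 0 < m ∧ σ ∣ m.toNat then α (m.toNat / σ) else 0) ((σ * x : ℕ) : ℤ)‖ ^ 2 := by
    have h := sum_filter_dvd_Icc_eq hσ (σ * X) (fun k ↦ ((‖(fun m : ℤ ↦ if 0 < m ∧ σ ∣ m.toNat then α (m.toNat / σ) else 0) (k : ℤ)‖ ^ 2 : ℝ) : ℂ))
    exact_mod_cast h
  rw [hsplit, hcast, Nat.mul_div_cancel_left X hσ]
  refine Finset.sum_congr rfl fun x hx ↦ ?_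
  rw [dilate_mul hσ α (mem_Icc.mp hx).1]

/-! ## §2. The bridge -/

/-- **Pascadi's Theorem 7.1 in the consumer's variables** (CONDITIONAL on the named fact `pascadi2025_theorem71`):
for every `ε > 0` there is `C` such that for all primes `q`, all `r` with `q ∤ r`, all `σ₁, σ₂ ≥ 1` and `X, Y` with
`1 ≤ σ₂Y ≤ σ₁X ≤ qr`, and all `α, β : ℕ → ℂ` whose support is coprime (`α_x β_y ≠ 0`, `x ≤ X`, `y ≤ Y` ⇒ `(σ₁x, σ₂y, qr) = 1`):
`‖Σ_{x≤X} Σ_{y≤Y} α_x β_y S(σ₁x, σ₂y; qr)‖ ≤ C ‖α‖₂ ‖β‖₂ (qr)^{1+ε} · (bracket71 (σ₁X) (σ₂Y) (qr) r r)^{1/6}`.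
[cite: Pascadi2025, Thm. 7.1 (case c = qr, a = 1)] -/
theorem norm_bilinear_dilated_le_of_pascadi (h : pascadi2025_theorem71) {ε : ℝ} (hε : 0 < ε) :
    ∃ C : ℝ, ∀ (q r : ℕ) [NeZero (q * r)], q.Prime → ¬ q ∣ r →
      ∀ (σ₁ σ₂ X Y : ℕ), 0 < σ₁ → 0 < σ₂ → 1 ≤ σ₂ * Y → σ₂ * Y ≤ σ₁ * X → σ₁ * X ≤ q * r →
      ∀ (α β : ℕ → ℂ),
        (∀ x ∈ Icc 1 X, ∀ y ∈ Icc 1 Y, α x * β y ≠ 0 → Nat.Coprime (Nat.gcd (σ₁ * x) (σ₂ * y)) (q * r)) →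
        ‖∑ x ∈ Icc 1 X, ∑ y ∈ Icc 1 Y, α x * β y *
            kloostermanSum (q * r) ((σ₁ * x : ℕ) : ZMod (q * r)) ((σ₂ * y : ℕ) : ZMod (q * r))‖ ≤
          C * Real.sqrt (∑ x ∈ Icc 1 X, ‖α x‖ ^ 2) * Real.sqrt (∑ y ∈ Icc 1 Y, ‖β y‖ ^ 2) *
            ((q * r : ℕ) : ℝ) ^ (1 + ε) *
            (Pascadi2025.bracket71 (σ₁ * X : ℕ) (σ₂ * Y : ℕ) ((q * r : ℕ) : ℝ) r r) ^ (1 / 6 : ℝ) := by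
  obtain ⟨C, hC⟩ := pascadi2025_theorem71_primeCofactor h ε hε
  refine ⟨C, ?_⟩
  intro q r _ hq hqr σ₁ σ₂ X Y hσ₁ hσ₂ hN hNM hMc α β hcop
  have key := hC q r hq hqr 0 0 (σ₁ * X) (σ₂ * Y) hN hNM hMc 1 isUnit_one (fun m : ℤ ↦ if 0 < m ∧ σ₁ ∣ m.toNat then α (m.toNat / σ₁) else 0)
    (fun m : ℤ ↦ if 0 < m ∧ σ₂ ∣ m.toNat then β (m.toNat / σ₂) else 0)
  rw [l2Norm_dilate hσ₁, l2Norm_dilate hσ₂] at key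
  -- identify Pascadi's restricted sum with ours
  have hsum : Pascadi2025.coprimeTypeIISum (q * r) 1 0 (σ₁ * X) 0 (σ₂ * Y) (fun m : ℤ ↦ if 0 < m ∧ σ₁ ∣ m.toNat then α (m.toNat / σ₁) else 0)
    (fun m : ℤ ↦ if 0 < m ∧ σ₂ ∣ m.toNat then β (m.toNat / σ₂) else 0) =
      ∑ x ∈ Icc 1 X, ∑ y ∈ Icc 1 Y, α x * β y *
        kloostermanSum (q * r) ((σ₁ * x : ℕ) : ZMod (q * r)) ((σ₂ * y : ℕ) : ZMod (q * r)) := by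
    unfold Pascadi2025.coprimeTypeIISum
    -- rewrite the indicator summand as `(fun m : ℤ ↦ if 0 < m ∧ σ₁ ∣ m.toNat then α (m.toNat / σ₁) else 0) m * (…)`
    have hterm : ∀ m n : ℤ,
        (if Nat.Coprime (Int.gcd m n) (q * r) then
          (fun m : ℤ ↦ if 0 < m ∧ σ₁ ∣ m.toNat then α (m.toNat / σ₁) else 0) m * (fun m : ℤ ↦ if 0 < m ∧ σ₂ ∣ m.toNat then β (m.toNat / σ₂) else 0) n * kloostermanSum (q * r) (1 * ((m : ℤ) : ZMod (q * r))) ((n : ℤ) : ZMod (q * r))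
          else 0) =
        (fun m : ℤ ↦ if 0 < m ∧ σ₁ ∣ m.toNat then α (m.toNat / σ₁) else 0) m * ((fun m : ℤ ↦ if 0 < m ∧ σ₂ ∣ m.toNat then β (m.toNat / σ₂) else 0) n *
          (if Nat.Coprime (Int.gcd m n) (q * r) then
            kloostermanSum (q * r) ((m : ℤ) : ZMod (q * r)) ((n : ℤ) : ZMod (q * r)) else 0)) := by
      intro m n
      split_ifs <;> simp [mul_assoc]
    simp_rw [hterm]
    simp_rw [← Finset.mul_sum]
    rw [sum_interval_dilate_mul hσ₁]
    refine Finset.sum_congr rfl fun x hx ↦ ?_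
    rw [sum_interval_dilate_mul hσ₂, Finset.mul_sum]
    refine Finset.sum_congr rfl fun y hy ↦ ?_
    by_cases hαβ : α x * β y = 0
    · have : α x * (β y * (if Nat.Coprime (Int.gcd ((σ₁ * x : ℕ) : ℤ) ((σ₂ * y : ℕ) : ℤ)) (q * r) then
          kloostermanSum (q * r) ((((σ₁ * x : ℕ) : ℤ) : ℤ) : ZMod (q * r)) ((((σ₂ * y : ℕ) : ℤ) : ℤ) : ZMod (q * r))
          else 0)) = 0 := by
        rw [← mul_assoc, hαβ, zero_mul]
      rw [this, hαβ, zero_mul]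
    · have hc : Nat.Coprime (Int.gcd ((σ₁ * x : ℕ) : ℤ) ((σ₂ * y : ℕ) : ℤ)) (q * r) := by
        rw [Int.gcd_natCast_natCast]
        exact hcop x hx y hy hαβ
      rw [if_pos hc]
      push_cast
      ring
  rw [hsum] at key
  exact key

/-! ## Appendix (same seat, same day): the transposed bridge (`σ₁X ≤ σ₂Y`)

Pascadi's Theorem 7.1 is stated for `N ≤ M` «only to shorten the statement; one can of course swap `m` and `n` in the bilinear
sum, up to swapping `M` and `N` in the upper bound» (footnote to Thm 7.1).  On the short windows of the print band the AFE side
`v = n₁'n₂' ≲ q̂^{2+η}` may be LONGER than the mollifier side `u = m₁'m₂' ≤ q̂^{2Δ'}`; the transposed form below covers it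
(Kloosterman sums are symmetric: `kloostermanSum_comm`). -/

/-- **The transposed Pascadi bridge** (CONDITIONAL on `pascadi2025_theorem71`): as `norm_bilinear_dilated_le_of_pascadi` but
with `1 ≤ σ₁X ≤ σ₂Y ≤ qr`, the bracket evaluated at `(σ₂Y, σ₁X)`. [cite: Pascadi2025, Thm. 7.1 (footnote: m and n swapped)] -/
theorem norm_bilinear_dilated_le_of_pascadi_transposed (h : pascadi2025_theorem71) {ε : ℝ} (hε : 0 < ε) :
    ∃ C : ℝ, ∀ (q r : ℕ) [NeZero (q * r)], q.Prime → ¬ q ∣ r →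
      ∀ (σ₁ σ₂ X Y : ℕ), 0 < σ₁ → 0 < σ₂ → 1 ≤ σ₁ * X → σ₁ * X ≤ σ₂ * Y → σ₂ * Y ≤ q * r →
      ∀ (α β : ℕ → ℂ),
        (∀ x ∈ Icc 1 X, ∀ y ∈ Icc 1 Y, α x * β y ≠ 0 → Nat.Coprime (Nat.gcd (σ₁ * x) (σ₂ * y)) (q * r)) →
        ‖∑ x ∈ Icc 1 X, ∑ y ∈ Icc 1 Y, α x * β y *
            kloostermanSum (q * r) ((σ₁ * x : ℕ) : ZMod (q * r)) ((σ₂ * y : ℕ) : ZMod (q * r))‖ ≤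
          C * Real.sqrt (∑ x ∈ Icc 1 X, ‖α x‖ ^ 2) * Real.sqrt (∑ y ∈ Icc 1 Y, ‖β y‖ ^ 2) *
            ((q * r : ℕ) : ℝ) ^ (1 + ε) *
            (Pascadi2025.bracket71 (σ₂ * Y : ℕ) (σ₁ * X : ℕ) ((q * r : ℕ) : ℝ) r r) ^ (1 / 6 : ℝ) := by
  obtain ⟨C, hC⟩ := norm_bilinear_dilated_le_of_pascadi h hε
  refine ⟨C, ?_⟩
  intro q r _ hq hqr σ₁ σ₂ X Y hσ₁ hσ₂ hN hNM hMc α β hcop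
  -- swap the two variables: `S(σ₁x, σ₂y) = S(σ₂y, σ₁x)`
  have hswap : ∑ x ∈ Icc 1 X, ∑ y ∈ Icc 1 Y, α x * β y *
      kloostermanSum (q * r) ((σ₁ * x : ℕ) : ZMod (q * r)) ((σ₂ * y : ℕ) : ZMod (q * r)) =
      ∑ y ∈ Icc 1 Y, ∑ x ∈ Icc 1 X, β y * α x *
        kloostermanSum (q * r) ((σ₂ * y : ℕ) : ZMod (q * r)) ((σ₁ * x : ℕ) : ZMod (q * r)) := by
    rw [Finset.sum_comm]
    refine Finset.sum_congr rfl fun y _ ↦ Finset.sum_congr rfl fun x _ ↦ ?_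
    rw [kloostermanSum_comm, mul_comm (α x)]
  rw [hswap]
  have hcop' : ∀ y ∈ Icc 1 Y, ∀ x ∈ Icc 1 X, β y * α x ≠ 0 →
      Nat.Coprime (Nat.gcd (σ₂ * y) (σ₁ * x)) (q * r) := by
    intro y hy x hx hne
    rw [Nat.gcd_comm]
    exact hcop x hx y hy (by rwa [mul_comm] at hne)
  have key := hC q r hq hqr σ₂ σ₁ Y X hσ₂ hσ₁ hN hNM hMc β α hcop'
  calc ‖∑ y ∈ Icc 1 Y, ∑ x ∈ Icc 1 X, β y * α x *
          kloostermanSum (q * r) ((σ₂ * y : ℕ) : ZMod (q * r)) ((σ₁ * x : ℕ) : ZMod (q * r))‖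
      ≤ C * Real.sqrt (∑ y ∈ Icc 1 Y, ‖β y‖ ^ 2) * Real.sqrt (∑ x ∈ Icc 1 X, ‖α x‖ ^ 2) *
          ((q * r : ℕ) : ℝ) ^ (1 + ε) *
          (Pascadi2025.bracket71 (σ₂ * Y : ℕ) (σ₁ * X : ℕ) ((q * r : ℕ) : ℝ) r r) ^ (1 / 6 : ℝ) := key
    _ = _ := by ring

end Summit.Parity.GeneralizedHardyLittlewood.Theorems.MomentsBeyondDiagonal.Layers

end
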